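import Summits.CriticalPhenomena.SAWScalingLimit.Theorems.LeftRightFKG.Negative.BoxMesh
import HarnessLib

/-!
# Negative knowledge on crux `LeftRightFKG`, part 7: rectangular lattice domains in general

Generic form of parts 3–4 (`BoxDomain`, `BoxMesh`, which treat the one box `{0..4} × {0..3}`): for ANY
closed lattice walk `C` tracing the boundary of the lattice rectangle `[x₀, x₁] × [y₀, y₁]`
(hypotheses, all decidable for an explicit `C`: vertices in the closed rectangle, consecutive vertices on a
common wall line, every wall lattice point visited, and a non-zero crossing count over one interior
probe), the crux's domain `Ω = {z | wind(C − z) ≠ 0}` at `δ = 1` has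
mesh vertices = mesh domain = the open box of sites `(x₀, x₁) × (y₀, y₁)` (`Rect.meshVertices_Ω`,
`Rect.meshDomain_Ω`), and adjacency in `Ω_1` is lattice adjacency inside the box (`Rect.dAdj_iff`);
walks of `Ω_1` stay in the mesh domain (`Rect.support_subset_meshDomain`).  This is the carrier identification every
certified finite instance of the crux (positive or negative) needs. [folklore]
-/

noncomputable section

open Real Set Complex Literature.Probability.LatticeModels Literature.Probability.RandomPlanarGeometry
  Literature.Topology.PlaneTopology

namespace Summit.CriticalPhenomena.SAWScalingLimit.Theorems.LeftRightFKG.Negative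

namespace Rect

variable (x₀ x₁ y₀ y₁ : ℤ)

/-- The open rectangle `(x₀, x₁) × (y₀, y₁)`. [folklore] -/
def Rint : Set ℂ := {z | ((x₀ : ℝ) < z.re ∧ z.re < x₁) ∧ ((y₀ : ℝ) < z.im ∧ z.im < y₁)}

/-- The closed rectangle `[x₀, x₁] × [y₀, y₁]`. [folklore] -/
def Rcl : Set ℂ := {z | ((x₀ : ℝ) ≤ z.re ∧ z.re ≤ x₁) ∧ ((y₀ : ℝ) ≤ z.im ∧ z.im ≤ y₁)}

/-- The sites strictly inside the rectangle. [folklore] -/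
def box : Set (Site 2) := {x | (x₀ < x 0 ∧ x 0 < x₁) ∧ (y₀ < x 1 ∧ x 1 < y₁)}

/-- The four wall lines. [folklore] -/
def Cbd : Set ℂ := {z | z.im = y₀ ∨ z.re = x₁ ∨ z.im = y₁ ∨ z.re = x₀}

/-- The crux's domain built from a closed lattice walk `C` at mesh `δ = 1`. [folklore] -/
def Ω {c : Site 2} (C : (zdGraph 2).Walk c c) : Set ℂ :=
  {z | wind (fun t : ℝ => Set.IccExtend zero_le_one (C.toCurve (meshPoint 1)) t - z) ≠ 0}

/-!
HYPOTHESES "`C` traces the boundary of the rectangle `[x₀, x₁] × [y₀, y₁]`" (all decidable for an explicit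
walk; passed explicitly, no predicate is introduced):
* `hb`     : `∀ x ∈ C.support, (x₀ ≤ x 0 ∧ x 0 ≤ x₁) ∧ (y₀ ≤ x 1 ∧ x 1 ≤ y₁)` (support in the closed rectangle);
* `hch`    : consecutive vertices lie on a common wall line (`List.IsChain` of the wall relation on `c :: tail`);
* `hcomp`  : every wall lattice point is a vertex of `C`;
* `hface`  : `x₀ ≤ m₀ ∧ m₀ + 1 ≤ x₁ ∧ y₀ ≤ k₀ ∧ k₀ + 1 ≤ y₁` (the reference face is inside);
* `hcross` : `pathCross m₀ k₀ c C.support.tail ≠ 0` (the walk winds about the reference probe).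
-/

variable {x₀ x₁ y₀ y₁}

/-- `convex_Rint` (auxiliary). [folklore] -/
theorem convex_Rint : Convex ℝ (Rint x₀ x₁ y₀ y₁) := by
  have h : Rint x₀ x₁ y₀ y₁ = ({z : ℂ | (x₀ : ℝ) < z.re} ∩ {z : ℂ | z.re < x₁}) ∩
      ({z : ℂ | (y₀ : ℝ) < z.im} ∩ {z : ℂ | z.im < y₁}) := by
    ext z; simp only [Rint, Set.mem_inter_iff, Set.mem_setOf_eq]
  rw [h]
  exact ((convex_halfSpace_re_gt _).inter (convex_halfSpace_re_lt _)).inter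
    ((convex_halfSpace_im_gt _).inter (convex_halfSpace_im_lt _))

/-- `isOpen_Rint` (auxiliary). [folklore] -/
theorem isOpen_Rint : IsOpen (Rint x₀ x₁ y₀ y₁) := by
  have h : Rint x₀ x₁ y₀ y₁ = ({z : ℂ | (x₀ : ℝ) < z.re} ∩ {z : ℂ | z.re < x₁}) ∩
      ({z : ℂ | (y₀ : ℝ) < z.im} ∩ {z : ℂ | z.im < y₁}) := by
    ext z; simp only [Rint, Set.mem_inter_iff, Set.mem_setOf_eq]
  rw [h]
  exact ((isOpen_lt continuous_const Complex.continuous_re).inter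
    (isOpen_lt Complex.continuous_re continuous_const)).inter
    ((isOpen_lt continuous_const Complex.continuous_im).inter
    (isOpen_lt Complex.continuous_im continuous_const))

/-- `convex_Rcl` (auxiliary). [folklore] -/
theorem convex_Rcl : Convex ℝ (Rcl x₀ x₁ y₀ y₁) := by
  have h : Rcl x₀ x₁ y₀ y₁ = ({z : ℂ | (x₀ : ℝ) ≤ z.re} ∩ {z : ℂ | z.re ≤ x₁}) ∩
      ({z : ℂ | (y₀ : ℝ) ≤ z.im} ∩ {z : ℂ | z.im ≤ y₁}) := by
    ext z; simp only [Rcl, Set.mem_inter_iff, Set.mem_setOf_eq]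
  rw [h]
  exact ((convex_halfSpace_re_ge _).inter (convex_halfSpace_re_le _)).inter
    ((convex_halfSpace_im_ge _).inter (convex_halfSpace_im_le _))

/-- `isClosed_Rcl` (auxiliary). [folklore] -/
theorem isClosed_Rcl : IsClosed (Rcl x₀ x₁ y₀ y₁) := by
  have h : Rcl x₀ x₁ y₀ y₁ = ({z : ℂ | (x₀ : ℝ) ≤ z.re} ∩ {z : ℂ | z.re ≤ x₁}) ∩
      ({z : ℂ | (y₀ : ℝ) ≤ z.im} ∩ {z : ℂ | z.im ≤ y₁}) := by
    ext z; simp only [Rcl, Set.mem_inter_iff, Set.mem_setOf_eq]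
  rw [h]
  exact ((isClosed_le continuous_const Complex.continuous_re).inter
    (isClosed_le Complex.continuous_re continuous_const)).inter
    ((isClosed_le continuous_const Complex.continuous_im).inter
    (isClosed_le Complex.continuous_im continuous_const))

/-- `Cbd_subset_compl_Rint` (auxiliary). [folklore] -/
theorem Cbd_subset_compl_Rint : Cbd x₀ x₁ y₀ y₁ ⊆ (Rint x₀ x₁ y₀ y₁)ᶜ := by
  intro z hz hR
  simp only [Cbd, mem_setOf_eq] at hz
  obtain ⟨⟨h1, h2⟩, h3, h4⟩ := hR
  rcases hz with h | h | h | h <;> linarith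

/-- `segment_subset_Cbd` (auxiliary). [folklore] -/
theorem segment_subset_Cbd {p q : Site 2}
    (h : (p 1 = y₀ ∧ q 1 = y₀) ∨ (p 0 = x₁ ∧ q 0 = x₁) ∨ (p 1 = y₁ ∧ q 1 = y₁) ∨ (p 0 = x₀ ∧ q 0 = x₀)) :
    segment ℝ (pt p) (pt q) ⊆ Cbd x₀ x₁ y₀ y₁ := by
  intro z hz
  simp only [Cbd, mem_setOf_eq]
  rcases h with ⟨hp, hq⟩ | ⟨hp, hq⟩ | ⟨hp, hq⟩ | ⟨hp, hq⟩
  · left; rw [im_eq_of_mem_segment (by rw [hp, hq]) hz, hp]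
  · right; left; rw [re_eq_of_mem_segment (by rw [hp, hq]) hz, hp]
  · right; right; left; rw [im_eq_of_mem_segment (by rw [hp, hq]) hz, hp]
  · right; right; right; rw [re_eq_of_mem_segment (by rw [hp, hq]) hz, hp]

section Boundary

variable {c : Site 2} {C : (zdGraph 2).Walk c c} {m₀ k₀ : ℤ}

/-- The base point of a boundary walk lies on a wall. [folklore] -/
theorem pt_c_mem_Cbd
    (hch : List.IsChain (fun p q : Site 2 => (p 1 = y₀ ∧ q 1 = y₀) ∨ (p 0 = x₁ ∧ q 0 = x₁) ∨
      (p 1 = y₁ ∧ q 1 = y₁) ∨ (p 0 = x₀ ∧ q 0 = x₀)) (c :: C.support.tail))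
    (hcross : pathCross m₀ k₀ c C.support.tail ≠ 0) : pt c ∈ Cbd x₀ x₁ y₀ y₁ := by
  cases hT : C.support.tail with
  | nil =>
    exfalso
    have : pathCross m₀ k₀ c C.support.tail = 0 := by rw [hT]; rfl
    exact hcross this
  | cons b l =>
    rw [hT, List.isChain_cons_cons] at hch
    simp only [Cbd, mem_setOf_eq, pt_re, pt_im]
    rcases hch.1 with ⟨hp, -⟩ | ⟨hp, -⟩ | ⟨hp, -⟩ | ⟨hp, -⟩
    · left; exact_mod_cast hp
    · right; left; exact_mod_cast hp
    · right; right; left; exact_mod_cast hp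
    · right; right; right; exact_mod_cast hp

/-- The trace of a boundary walk lies on the wall lines. [folklore] -/
theorem range_C_subset_Cbd
    (hch : List.IsChain (fun p q : Site 2 => (p 1 = y₀ ∧ q 1 = y₀) ∨ (p 0 = x₁ ∧ q 0 = x₁) ∨
      (p 1 = y₁ ∧ q 1 = y₁) ∨ (p 0 = x₀ ∧ q 0 = x₀)) (c :: C.support.tail))
    (hcross : pathCross m₀ k₀ c C.support.tail ≠ 0) :
    range (poly c C.support.tail) ⊆ Cbd x₀ x₁ y₀ y₁ :=
  range_poly_subset_of_isChain c _ (pt_c_mem_Cbd hch hcross) (hch.imp fun _ _ h => segment_subset_Cbd h)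

/-- The trace of a boundary walk lies in the closed rectangle. [folklore] -/
theorem range_C_subset_Rcl (hb : ∀ x ∈ C.support, (x₀ ≤ x 0 ∧ x 0 ≤ x₁) ∧ (y₀ ≤ x 1 ∧ x 1 ≤ y₁)) :
    range (poly c C.support.tail) ⊆ Rcl x₀ x₁ y₀ y₁ := by
  refine range_poly_subset convex_Rcl c _ ?_ fun x hx => ?_
  · obtain ⟨⟨h1, h2⟩, h3, h4⟩ := hb c C.start_mem_support
    simp only [Rcl, mem_setOf_eq, pt_re, pt_im]
    refine ⟨⟨?_, ?_⟩, ?_, ?_⟩ <;> assumption_mod_cast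
  · obtain ⟨⟨h1, h2⟩, h3, h4⟩ := hb x (List.mem_of_mem_tail hx)
    simp only [Rcl, mem_setOf_eq, pt_re, pt_im]
    refine ⟨⟨?_, ?_⟩, ?_, ?_⟩ <;> assumption_mod_cast

omit c C in
/-- `probe_mem_Rint` (auxiliary). [folklore] -/
theorem probe_mem_Rint (hface : x₀ ≤ m₀ ∧ m₀ + 1 ≤ x₁ ∧ y₀ ≤ k₀ ∧ k₀ + 1 ≤ y₁) :
    probeL m₀ k₀ ∈ Rint x₀ x₁ y₀ y₁ := by
  obtain ⟨h1, h2, h3, h4⟩ := hface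
  simp only [Rint, mem_setOf_eq, probeL_re, probeL_im]
  have i1 : (x₀ : ℝ) ≤ m₀ := by exact_mod_cast h1
  have i2 : (m₀ : ℝ) + 1 ≤ x₁ := by exact_mod_cast h2
  have i3 : (y₀ : ℝ) ≤ k₀ := by exact_mod_cast h3
  have i4 : (k₀ : ℝ) + 1 ≤ y₁ := by exact_mod_cast h4
  refine ⟨⟨by linarith, by linarith⟩, by linarith, by linarith⟩

omit m₀ k₀ in
/-- The loop function of the crux for `C`, as a `Path.extend`. [folklore] -/
theorem C_loop_apply (t : ℝ) :
    Set.IccExtend zero_le_one (C.toCurve (meshPoint 1)) t = (poly c C.support.tail).extend t :=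
  iccExtend_toCurve_apply C t

/-- **The winding number of the boundary walk about the reference probe** is minus its crossing
count. [folklore] -/
theorem wind_C_probe (hb : ∀ x ∈ C.support, (x₀ ≤ x 0 ∧ x 0 ≤ x₁) ∧ (y₀ ≤ x 1 ∧ x 1 ≤ y₁))
    (hface : x₀ ≤ m₀ ∧ m₀ + 1 ≤ x₁ ∧ y₀ ≤ k₀ ∧ k₀ + 1 ≤ y₁) :
    wind (fun t : ℝ => (poly c C.support.tail).extend t - probeL m₀ k₀) = -pathCross m₀ k₀ c C.support.tail := by
  obtain ⟨-, -, -, h4⟩ := hface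
  have h := wind_poly_probeL (m := m₀) (k := k₀) (Y := y₁) (by omega) c C.support.tail
    (isChain_support (fun _ _ h => h) C) (hb c C.start_mem_support).2.2
    (fun x hx => (hb x (List.mem_of_mem_tail hx)).2.2) (poly_fst_walk C)
  exact_mod_cast h

/-- **Inside the rectangle the boundary walk has the winding number of the probe.** [folklore] -/
theorem wind_C_of_mem_Rint (hb : ∀ x ∈ C.support, (x₀ ≤ x 0 ∧ x 0 ≤ x₁) ∧ (y₀ ≤ x 1 ∧ x 1 ≤ y₁))
    (hch : List.IsChain (fun p q : Site 2 => (p 1 = y₀ ∧ q 1 = y₀) ∨ (p 0 = x₁ ∧ q 0 = x₁) ∨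
      (p 1 = y₁ ∧ q 1 = y₁) ∨ (p 0 = x₀ ∧ q 0 = x₀)) (c :: C.support.tail))
    (hface : x₀ ≤ m₀ ∧ m₀ + 1 ≤ x₁ ∧ y₀ ≤ k₀ ∧ k₀ + 1 ≤ y₁)
    (hcross : pathCross m₀ k₀ c C.support.tail ≠ 0) {z : ℂ} (hz : z ∈ Rint x₀ x₁ y₀ y₁) :
    wind (fun t : ℝ => (poly c C.support.tail).extend t - z) = -pathCross m₀ k₀ c C.support.tail := by
  rw [← wind_C_probe hb hface]
  symm
  set P := poly c C.support.tail
  have hK : IsClosed (Rint x₀ x₁ y₀ y₁)ᶜ := isOpen_Rint.isClosed_compl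
  have hmaps : MapsTo P.extend (Icc 0 1) (Rint x₀ x₁ y₀ y₁)ᶜ := fun t ht => by
    rw [Path.extend_apply P ht]
    exact Cbd_subset_compl_Rint (range_C_subset_Cbd hch hcross ⟨_, rfl⟩)
  have h01 : P.extend 0 = P.extend 1 := by
    rw [Path.extend_zero, Path.extend_one, poly_fst_walk C]
  refine wind_sub_eq_of_mem_connectedComponentIn P.continuous_extend.continuousOn h01 hK hmaps ?_
  rw [compl_compl]
  exact convex_Rint.isPreconnected.subset_connectedComponentIn (probe_mem_Rint hface) Subset.rfl hz

/-- `Rint_subset_Ω` (auxiliary). [folklore] -/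
theorem Rint_subset_Ω (hb : ∀ x ∈ C.support, (x₀ ≤ x 0 ∧ x 0 ≤ x₁) ∧ (y₀ ≤ x 1 ∧ x 1 ≤ y₁))
    (hch : List.IsChain (fun p q : Site 2 => (p 1 = y₀ ∧ q 1 = y₀) ∨ (p 0 = x₁ ∧ q 0 = x₁) ∨
      (p 1 = y₁ ∧ q 1 = y₁) ∨ (p 0 = x₀ ∧ q 0 = x₀)) (c :: C.support.tail))
    (hface : x₀ ≤ m₀ ∧ m₀ + 1 ≤ x₁ ∧ y₀ ≤ k₀ ∧ k₀ + 1 ≤ y₁)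
    (hcross : pathCross m₀ k₀ c C.support.tail ≠ 0) : Rint x₀ x₁ y₀ y₁ ⊆ Ω C := fun z hz => by
  simp only [Ω, mem_setOf_eq, C_loop_apply, wind_C_of_mem_Rint hb hch hface hcross hz, ne_eq, neg_eq_zero]
  exact_mod_cast hcross

omit m₀ k₀ in
/-- Vertices of `C` are not in `Ω` (junk value `0` on the trace). [folklore] -/
theorem not_mem_Ω_of_mem_support {x : Site 2} (hx : x ∈ C.support) : pt x ∉ Ω C := by
  simp only [Ω, mem_setOf_eq, not_not, C_loop_apply]
  apply wind_eq_zero_of_mem_range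
  have hmem : pt x ∈ pt c :: C.support.tail.map pt := by
    rw [← List.map_cons, C.cons_tail_support]; exact List.mem_map_of_mem hx
  exact mem_range_polylineFrom _ _ hmem

omit m₀ k₀ in
/-- **Outside the closed rectangle the boundary walk does not wind.** [folklore] -/
theorem not_mem_Ω_of_not_mem_Rcl (hb : ∀ x ∈ C.support, (x₀ ≤ x 0 ∧ x 0 ≤ x₁) ∧ (y₀ ≤ x 1 ∧ x 1 ≤ y₁))
    {z : ℂ} (hz : z ∉ Rcl x₀ x₁ y₀ y₁) : z ∉ Ω C := by
  simp only [Ω, mem_setOf_eq, not_not, C_loop_apply]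
  refine wind_poly_eq_zero_far c _ (poly_fst_walk C) isClosed_Rcl (range_C_subset_Rcl hb) hz ?_
  intro M
  have hz' : (z.re < x₀ ∨ (x₁ : ℝ) < z.re) ∨ (z.im < y₀ ∨ (y₁ : ℝ) < z.im) := by
    simp only [Rcl, mem_setOf_eq, not_and_or, not_le] at hz
    exact hz
  rcases hz' with (h | h) | (h | h)
  · refine ⟨⟨min z.re 0 - |M| - 1, z.im⟩, ?_, ?_⟩
    · have h1 := abs_re_le_norm (⟨min z.re 0 - |M| - 1, z.im⟩ : ℂ)
      have h2 : (⟨min z.re 0 - |M| - 1, z.im⟩ : ℂ).re = min z.re 0 - |M| - 1 := rfl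
      rw [h2, abs_of_nonpos (by have := min_le_right z.re 0; have := abs_nonneg M; linarith)] at h1
      have := le_abs_self M; have := min_le_right z.re 0; linarith
    · intro y hy hyR
      obtain ⟨-, hhi⟩ := re_mem_of_mem_segment hy
      have hm : max z.re (min z.re 0 - |M| - 1) = z.re :=
        max_eq_left (by have := min_le_left z.re 0; have := abs_nonneg M; linarith)
      rw [show (⟨min z.re 0 - |M| - 1, z.im⟩ : ℂ).re = min z.re 0 - |M| - 1 from rfl, hm] at hhi
      exact absurd hyR.1.1 (by linarith)
  · refine ⟨⟨max z.re 0 + |M| + 1, z.im⟩, ?_, ?_⟩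
    · have h1 := abs_re_le_norm (⟨max z.re 0 + |M| + 1, z.im⟩ : ℂ)
      have h2 : (⟨max z.re 0 + |M| + 1, z.im⟩ : ℂ).re = max z.re 0 + |M| + 1 := rfl
      rw [h2, abs_of_nonneg (by have := le_max_right z.re 0; have := abs_nonneg M; linarith)] at h1
      have := le_abs_self M; have := le_max_right z.re 0; linarith
    · intro y hy hyR
      obtain ⟨hlo, -⟩ := re_mem_of_mem_segment hy
      have hm : min z.re (max z.re 0 + |M| + 1) = z.re :=
        min_eq_left (by have := le_max_left z.re 0; have := abs_nonneg M; linarith)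
      rw [show (⟨max z.re 0 + |M| + 1, z.im⟩ : ℂ).re = max z.re 0 + |M| + 1 from rfl, hm] at hlo
      exact absurd hyR.1.2 (by linarith)
  · refine ⟨⟨z.re, min z.im 0 - |M| - 1⟩, ?_, ?_⟩
    · have h1 := abs_im_le_norm (⟨z.re, min z.im 0 - |M| - 1⟩ : ℂ)
      have h2 : (⟨z.re, min z.im 0 - |M| - 1⟩ : ℂ).im = min z.im 0 - |M| - 1 := rfl
      rw [h2, abs_of_nonpos (by have := min_le_right z.im 0; have := abs_nonneg M; linarith)] at h1
      have := le_abs_self M; have := min_le_right z.im 0; linarith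
    · intro y hy hyR
      obtain ⟨-, hhi⟩ := im_mem_of_mem_segment hy
      have hm : max z.im (min z.im 0 - |M| - 1) = z.im :=
        max_eq_left (by have := min_le_left z.im 0; have := abs_nonneg M; linarith)
      rw [show (⟨z.re, min z.im 0 - |M| - 1⟩ : ℂ).im = min z.im 0 - |M| - 1 from rfl, hm] at hhi
      exact absurd hyR.2.1 (by linarith)
  · refine ⟨⟨z.re, max z.im 0 + |M| + 1⟩, ?_, ?_⟩
    · have h1 := abs_im_le_norm (⟨z.re, max z.im 0 + |M| + 1⟩ : ℂ)
      have h2 : (⟨z.re, max z.im 0 + |M| + 1⟩ : ℂ).im = max z.im 0 + |M| + 1 := rfl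
      rw [h2, abs_of_nonneg (by have := le_max_right z.im 0; have := abs_nonneg M; linarith)] at h1
      have := le_abs_self M; have := le_max_right z.im 0; linarith
    · intro y hy hyR
      obtain ⟨hlo, -⟩ := im_mem_of_mem_segment hy
      have hm : min z.im (max z.im 0 + |M| + 1) = z.im :=
        min_eq_left (by have := le_max_left z.im 0; have := abs_nonneg M; linarith)
      rw [show (⟨z.re, max z.im 0 + |M| + 1⟩ : ℂ).im = max z.im 0 + |M| + 1 from rfl, hm] at hlo
      exact absurd hyR.2.2 (by linarith)

/-- **The mesh vertices of `Ω` are exactly the sites strictly inside the rectangle.** [folklore] -/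
theorem meshVertices_Ω (hb : ∀ x ∈ C.support, (x₀ ≤ x 0 ∧ x 0 ≤ x₁) ∧ (y₀ ≤ x 1 ∧ x 1 ≤ y₁))
    (hch : List.IsChain (fun p q : Site 2 => (p 1 = y₀ ∧ q 1 = y₀) ∨ (p 0 = x₁ ∧ q 0 = x₁) ∨
      (p 1 = y₁ ∧ q 1 = y₁) ∨ (p 0 = x₀ ∧ q 0 = x₀)) (c :: C.support.tail))
    (hcomp : ∀ i j : ℤ, x₀ ≤ i → i ≤ x₁ → y₀ ≤ j → j ≤ y₁ →
      (i = x₀ ∨ i = x₁ ∨ j = y₀ ∨ j = y₁) → bx i j ∈ C.support)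
    (hface : x₀ ≤ m₀ ∧ m₀ + 1 ≤ x₁ ∧ y₀ ≤ k₀ ∧ k₀ + 1 ≤ y₁)
    (hcross : pathCross m₀ k₀ c C.support.tail ≠ 0) : meshVertices (Ω C) 1 = box x₀ x₁ y₀ y₁ := by
  ext x
  rw [mem_meshVertices_iff, meshPoint_one]
  constructor
  · intro hx
    by_contra hbox
    by_cases hR : pt x ∈ Rcl x₀ x₁ y₀ y₁
    · obtain ⟨⟨h1, h2⟩, h3, h4⟩ := hR
      simp only [pt_re, pt_im] at h1 h2 h3 h4
      have i1 : x₀ ≤ x 0 := by exact_mod_cast h1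
      have i2 : x 0 ≤ x₁ := by exact_mod_cast h2
      have i3 : y₀ ≤ x 1 := by exact_mod_cast h3
      have i4 : x 1 ≤ y₁ := by exact_mod_cast h4
      have hb' : x 0 = x₀ ∨ x 0 = x₁ ∨ x 1 = y₀ ∨ x 1 = y₁ := by
        simp only [box, mem_setOf_eq] at hbox; omega
      have hmem := hcomp (x 0) (x 1) i1 i2 i3 i4 hb'
      rw [← eq_bx x] at hmem
      exact not_mem_Ω_of_mem_support hmem hx
    · exact not_mem_Ω_of_not_mem_Rcl hb hR hx
  · intro hx
    obtain ⟨⟨h1, h2⟩, h3, h4⟩ := hx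
    apply Rint_subset_Ω hb hch hface hcross
    simp only [Rint, mem_setOf_eq, pt_re, pt_im]
    refine ⟨⟨?_, ?_⟩, ?_, ?_⟩ <;> assumption_mod_cast

end Boundary

end Rect

end Summit.CriticalPhenomena.SAWScalingLimit.Theorems.LeftRightFKG.Negative
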